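import Literature.AlgebraicGeometry.AbelianSchemes.AbelianSchemeSymplecticLevel
import Literature.AlgebraicGeometry.AbelianSchemes.AbelianSchemeFibreHom
import Literature.AlgebraicGeometry.AbelianSchemes.AbelianSchemeOverSectionPow
import HarnessLib

/-!
# The Hecke-moved torsion tower of an abelian scheme read through an isogeny: `w ↦ u_s(Λ.lift_{νM}(γ⋆ w))`
# ([Lan2013PELCompactifications] §1.3.6; [Deligne1971TravauxShimura] 4.11–4.12; [MumfordFogartyKirwan1994] Ch. 6 §2, Ch. 7 §1)

[Deligne1971TravauxShimura, 4.11 (p. 148)]: «l'action de `G(𝔸_f)` … se décrit en termes d'isogénies»: the Hecke operator of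
`γ ∈ GSp_{2g}(ℚ)` sends the marked abelian variety `(A, Λ : ẑ^{2g} ⥲ T̂A)` to the ISOGENY QUOTIENT `B = A/K`,
`K = γ⁻¹ℤ^{2g}/ℤ^{2g}` read through `Λ`, whose own marking is `a ↦ ψ(Λ(γ⁻¹a))`.  On the TORSION TOWER of the tree's symplectic
lifts (★ `LevelStructure.SymplecticLift`: `lift M : (ℤ/M)^{2g} ⥲ A_s[M](Ω)`, [Lan2013PELCompactifications, Lemma 1.3.6.5])
this marking of `B` is, at level `M` with `N ∣ M` (source level `N·ν`, `γ⋆ := νγ⁻¹ ∈ M_{2g}(ℤ)`):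

  **`lift′_M(a) := u_s(Λ.lift_{νM}(γ⋆ ã))`**, `ã ∈ ℤ^{2g}` any lift of `a ∈ (ℤ/M)^{2g}`.

THIS FILE is the arithmetic of that point map, for a homomorphism `u : A → B` of abelian schemes over a base `S`
(★ `AbelianSchemeOverBase`, Mathlib `IsMonHom`) read on the geometric fibre at `s` through ★ `fibreHom u s`, with the
KERNEL HYPOTHESIS «`u_s` kills the points `φ′(N·γ⋆z)(s)`» (resp. «the kernel of `u_s` is exactly these points») stated in
the currency of the source level-`N·ν` structure `φ′` (★ `LevelStructure.section_`, `restrictPt`):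
* `map_fibreHom_restrictPt` — `u_s(σ(s)) = (σ ≫ u)(s)`; `coe_lift_ofAdd_eq_restrictPt_section` — `Λ.lift_N(c) = φ(c)(s)` for
  every exponent vector; `natCast_ne_zero` — at a point carrying a symplectic lift no positive integer vanishes in `Ω`;
* `map_lift_mulVec_add/_nsmul` — additivity of the point map in `w ∈ ℤ^{2g}`; `coe_lift_mulVec_smul_eq_restrictPt` — the
  kernel lattice `γ⋆(Mℤ^{2g})` at level `νM` IS `φ′(N·γ⋆ℤ^{2g})` (tower compatibility); `map_lift_mulVec_smul_eq_one`,
  `map_lift_mulVec_congr` (WELL-DEFINED mod `M`), `map_lift_mulVec_pow_eq_one` (`M`-TORSION);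
* `exists_eq_smul_of_map_lift_mulVec_eq_one` — INJECTIVITY mod `M` from the exact kernel and `γγ⋆ = ν` (γ integral);
* `map_lift_mulVec_single` — the LEVEL CLAUSE: at level `N` the point map is the induced level structure `u ∘ φ′^ν`, by
  `γ⋆γ = ν` and `γ ≡ 1 (mod N)` — [MumfordFogartyKirwan1994, Ch. 7 §1 Def. 7.1], the sections `σᵢ ≫ u`.
The symplectic lift of the quotient built from these (bijectivity by counting, the Weil-pairing clause) is
`AbelianSchemes/SymplecticLiftOfIsogeny`.  Theorems only (no `def`, no named fact, no instance); cell hodgecm-mathlib, seat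
B-p04 (g17), E-road HECKE-LINK socket (B) (the `symplectic` field of the isogeny-quotient triple).  HC_CM is proved only
modulo the 7 printed citations until rung 0 closes; this file discharges none of them.

## References
* [Lan2013PELCompactifications] K.-W. Lan, *Arithmetic compactifications of PEL-type Shimura varieties* (2013), §1.3.6
  Def. 1.3.6.2 (p. 80), Lemma 1.3.6.5 (p. 81).
* [Deligne1971TravauxShimura] P. Deligne, *Travaux de Shimura*, Sém. Bourbaki 389 (1971), 4.11–4.12 (pp. 148–149).
* [MumfordFogartyKirwan1994] D. Mumford, J. Fogarty, F. Kirwan, *Geometric Invariant Theory*, 3rd ed. (1994), Ch. 6 §2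
  Def. 6.3 (p. 120), Ch. 7 §1 Def. 7.1 (p. 129).
-/

noncomputable section

universe u

open CategoryTheory CategoryTheory.Limits AlgebraicGeometry MonoidalCategory Matrix
open scoped MonObj

namespace Literature.AlgebraicGeometry.AbelianSchemes

namespace AbelianSchemeOver

open Literature.AlgebraicGeometry.Motives
open Literature.AlgebraicGeometry.ModuliOfAbelianVarieties (typeForm)


variable {S : Scheme.{u}} {A B : AbelianSchemeOver S} {Ω : Type u} [Field Ω] (s : Spec (.of Ω) ⟶ S)

/-! ### §1 Bridges: sections through `u` read on the fibre; the tower of a symplectic lift reads the level structure -/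

/-- **`u_s(σ(s)) = (σ ≫ u)(s)`**: the fibre homomorphism `u_s : A_s → B_s` (★ `fibreHom`) carries the `Ω`-point of a section
`σ` of `A` to the `Ω`-point of the induced section `σ ≫ u` of `B` (both lie over `s ≫ σ ≫ u`, ★ `fibrePointToLeft_injective`).
[cite: MumfordFogartyKirwan1994, Ch. 6 §2 Definition 6.3 (p. 120)] -/
theorem map_fibreHom_restrictPt (u : A.X ⟶ B.X) [IsMonHom u] (σ : A.Sections) :
    AlgPoints.map (fibreHom u s).hom.hom.hom (A.restrictPt s σ) = B.restrictPt s (σ ≫ u) := by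
  apply B.fibrePointToLeft_injective s
  rw [fibrePointToLeft_map_fibreHom]
  change ((A.restrictPt s σ).left ≫ pullback.fst A.X.hom s) ≫ u.left =
    (B.restrictPt s (σ ≫ u)).left ≫ pullback.fst B.X.hom s
  rw [restrictPt_left_fst, restrictPt_left_fst, Over.comp_left]
  exact Category.assoc _ _ _

namespace LevelStructure.SymplecticLift

variable {g N : ℕ} {φ : A.LevelStructure g N} {s}
  {Θ : CartierDivisor (A.fibre s).toAbelianVariety.X.left} {δ : Fin g → ℕ} (Λ : φ.SymplecticLift s Θ δ)

/-- A monoid homomorphism out of `Multiplicative ((ℤ/M)^{2g})`, `M ≥ 1`, is determined by its values on the basis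
vectors: `L(a) = ∏ₖ L(eₖ)^{aₖ}`. [folklore] -/
private theorem map_ofAdd_eq_prod_pow {M : ℕ} [NeZero M] {H : Type*} [CommMonoid H]
    (L : Multiplicative (Fin g ⊕ Fin g → ZMod M) →* H) (a : Fin g ⊕ Fin g → ZMod M) :
    L (Multiplicative.ofAdd a) = ∏ k, L (Multiplicative.ofAdd (Pi.single k 1)) ^ (a k).val := by
  have ha : a = ∑ k, (a k).val • (Pi.single k (1 : ZMod M)) := by
    funext i
    simp only [Finset.sum_apply, Pi.smul_apply, Pi.single_apply]
    rw [Finset.sum_eq_single i (fun k _ hk => by simp [Ne.symm hk]) (by simp)]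
    simp
  conv_lhs => rw [ha]
  rw [ofAdd_sum, map_prod]
  refine Finset.prod_congr rfl fun k _ => ?_
  rw [ofAdd_nsmul, map_pow]

/-- **At its own level the tower IS the level structure, on every exponent vector**: `lift_N(c) = φ(c)(s)` for all
`c ∈ (ℤ/N)^{2g}` (★ `lift_level` on the basis, extended multiplicatively; ★ `restrictPt_sectionPow_eq_prod`).
[cite: Lan2013PELCompactifications, §1.3.6 Lemma 1.3.6.5 (p. 81)] -/
theorem coe_lift_ofAdd_eq_restrictPt_section [NeZero N] (c : Fin g ⊕ Fin g → ZMod N) :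
    ((Λ.lift N (Multiplicative.ofAdd c)) : (A.fibre s).toAbelianVariety.Points Ω) = A.restrictPt s (φ.section_ c) := by
  rw [map_ofAdd_eq_prod_pow, Subgroup.val_finsetProd]
  simp_rw [SubgroupClass.coe_pow, Λ.lift_level]
  rw [LevelStructure.section_, A.restrictPt_sectionPow_eq_prod s φ.σ c]
  rfl

include Λ in
/-- **The residue characteristic of a point carrying a symplectic lift kills no positive integer**: `(M : Ω) ≠ 0` for
`M ≠ 0` — the tower has a primitive `M·N`-th root of unity in `Ω` (★ `isPrimitiveRoot_ζ`; the structure is empty in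
positive characteristic). [cite: Lan2013PELCompactifications, §1.3.6 Def. 1.3.6.2 (p. 80)] -/
theorem natCast_ne_zero (hN : N ≠ 0) {M : ℕ} (hM : M ≠ 0) : (M : Ω) ≠ 0 := by
  have hprim := Λ.isPrimitiveRoot_ζ (Dvd.intro_left M rfl) (Nat.mul_ne_zero hM hN)
  haveI : NeZero (M * N) := ⟨Nat.mul_ne_zero hM hN⟩
  have h := (hprim.neZero' : NeZero ((M * N : ℕ) : Ω)).out
  rw [Nat.cast_mul] at h
  exact left_ne_zero_of_mul h

/-- Re-indexing the tower along an EQUALITY of levels, for vectors of integer residues (proof plumbing for the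
dependent level index). [cite: Lan2013PELCompactifications, §1.3.6 Lemma 1.3.6.5 (p. 81)] -/
theorem coe_lift_intCast_congr {a b : ℕ} (h : a = b) (w : Fin g ⊕ Fin g → ℤ) :
    ((Λ.lift a (Multiplicative.ofAdd fun j => ((w j : ℤ) : ZMod a))) : (A.fibre s).toAbelianVariety.Points Ω) =
      Λ.lift b (Multiplicative.ofAdd fun j => ((w j : ℤ) : ZMod b)) := by
  subst h
  rfl

end LevelStructure.SymplecticLift

/-! ### §2 The homomorphism of fibres on points: multiplicativity (private plumbing) -/

section FibreHomPoints

variable {s} (u : A.X ⟶ B.X) [IsMonHom u]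

/-- `u_s` is multiplicative on `Ω`-points (Mathlib `IsMonHom.monoidHom`). [folklore] -/
private theorem map_fibreHom_mul (P Q : (A.fibre s).toAbelianVariety.Points Ω) :
    AlgPoints.map (fibreHom u s).hom.hom.hom (P * Q) =
      AlgPoints.map (fibreHom u s).hom.hom.hom P * AlgPoints.map (fibreHom u s).hom.hom.hom Q :=
  map_mul (IsMonHom.monoidHom (fibreHom u s).hom.hom.hom (specOver Ω Ω)) P Q

/-- `u_s` sends `1` to `1` on `Ω`-points. [folklore] -/
private theorem map_fibreHom_one :
    AlgPoints.map (fibreHom u s).hom.hom.hom (1 : (A.fibre s).toAbelianVariety.Points Ω) = 1 :=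
  map_one (IsMonHom.monoidHom (fibreHom u s).hom.hom.hom (specOver Ω Ω))

/-- `u_s` commutes with powers on `Ω`-points. [folklore] -/
private theorem map_fibreHom_pow (P : (A.fibre s).toAbelianVariety.Points Ω) (n : ℕ) :
    AlgPoints.map (fibreHom u s).hom.hom.hom (P ^ n) = AlgPoints.map (fibreHom u s).hom.hom.hom P ^ n :=
  map_pow (IsMonHom.monoidHom (fibreHom u s).hom.hom.hom (specOver Ω Ω)) P n

/-- `u_s` maps `M`-torsion points to `M`-torsion points. [folklore] -/
private theorem map_fibreHom_mem_torsionPoints {n : ℤ} {P : (A.fibre s).toAbelianVariety.Points Ω}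
    (hP : P ∈ (A.fibre s).toAbelianVariety.torsionPoints Ω n) :
    AlgPoints.map (fibreHom u s).hom.hom.hom P ∈ (B.fibre s).toAbelianVariety.torsionPoints Ω n :=
  AbelianVariety.map_mem_torsionPoints (fibreHom u s) hP

end FibreHomPoints

/-! ### §3 The `γ⋆`-moved tower read through `u`: the point map `w ↦ u_s(Λ.lift_{νM}(γ⋆ w))` on integer vectors -/

namespace LevelStructure.SymplecticLift

variable {g N ν : ℕ} {φ' : A.LevelStructure g (N * ν)} {s}
  {ΘA : CartierDivisor (A.fibre s).toAbelianVariety.X.left} {δ : Fin g → ℕ}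
  (Λ : φ'.SymplecticLift s ΘA δ) (u : A.X ⟶ B.X) [IsMonHom u]
  (γs : Matrix (Fin g ⊕ Fin g) (Fin g ⊕ Fin g) ℤ)

/-- ADDITIVITY of the point map in the integer vector: `u_s Λ_{νM}(γ⋆(w₁ + w₂)) = u_s Λ_{νM}(γ⋆ w₁) · u_s Λ_{νM}(γ⋆ w₂)`.
[cite: Lan2013PELCompactifications, §1.3.6 Lemma 1.3.6.5 (p. 81)] -/
theorem map_lift_mulVec_add (M : ℕ) (w₁ w₂ : Fin g ⊕ Fin g → ℤ) :
    AlgPoints.map (fibreHom u s).hom.hom.hom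
        ((Λ.lift (ν * M) (Multiplicative.ofAdd fun j => (((γs *ᵥ (w₁ + w₂)) j : ℤ) : ZMod (ν * M)))) :
          (A.fibre s).toAbelianVariety.Points Ω) =
      AlgPoints.map (fibreHom u s).hom.hom.hom
          ((Λ.lift (ν * M) (Multiplicative.ofAdd fun j => (((γs *ᵥ w₁) j : ℤ) : ZMod (ν * M)))) :
            (A.fibre s).toAbelianVariety.Points Ω) *
        AlgPoints.map (fibreHom u s).hom.hom.hom
          ((Λ.lift (ν * M) (Multiplicative.ofAdd fun j => (((γs *ᵥ w₂) j : ℤ) : ZMod (ν * M)))) :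
            (A.fibre s).toAbelianVariety.Points Ω) := by
  have hv : (fun j => (((γs *ᵥ (w₁ + w₂)) j : ℤ) : ZMod (ν * M))) =
      (fun j => (((γs *ᵥ w₁) j : ℤ) : ZMod (ν * M))) + fun j => (((γs *ᵥ w₂) j : ℤ) : ZMod (ν * M)) := by
    funext j
    rw [Matrix.mulVec_add, Pi.add_apply, Int.cast_add, Pi.add_apply]
  rw [hv, ofAdd_add, map_mul, Subgroup.coe_mul, map_fibreHom_mul]

/-- SCALING: `u_s Λ_{νM}(γ⋆(c • w)) = (u_s Λ_{νM}(γ⋆ w))^c` for `c : ℕ`. [cite: Lan2013PELCompactifications, §1.3.6 Lemma 1.3.6.5 (p. 81)] -/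
theorem map_lift_mulVec_nsmul (M c : ℕ) (w : Fin g ⊕ Fin g → ℤ) :
    AlgPoints.map (fibreHom u s).hom.hom.hom
        ((Λ.lift (ν * M) (Multiplicative.ofAdd fun j => (((γs *ᵥ ((c : ℤ) • w)) j : ℤ) : ZMod (ν * M)))) :
          (A.fibre s).toAbelianVariety.Points Ω) =
      AlgPoints.map (fibreHom u s).hom.hom.hom
          ((Λ.lift (ν * M) (Multiplicative.ofAdd fun j => (((γs *ᵥ w) j : ℤ) : ZMod (ν * M)))) :
            (A.fibre s).toAbelianVariety.Points Ω) ^ c := by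
  have hv : (fun j => (((γs *ᵥ ((c : ℤ) • w)) j : ℤ) : ZMod (ν * M))) =
      c • fun j => (((γs *ᵥ w) j : ℤ) : ZMod (ν * M)) := by
    funext j
    rw [Matrix.mulVec_smul, Pi.smul_apply, Pi.smul_apply, smul_eq_mul, Int.cast_mul, Int.cast_natCast,
      nsmul_eq_mul]
  rw [hv, ofAdd_nsmul, map_pow, Subgroup.coe_pow, map_fibreHom_pow]

/-- THE KERNEL LATTICE, read through the tower: for `N ∣ M`, `Λ_{νM}(γ⋆(M • z)) = φ′(N·γ⋆ z)(s)` — the `Ω`-point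
`γ⁻¹ z mod Λ` of the Hecke kernel, written once at level `νM` and once through the level-`N·ν` structure `φ′`
(tower compatibility ★ `lift_compat` + ★ `coe_lift_ofAdd_eq_restrictPt_section`).
[cite: Lan2013PELCompactifications, §1.3.6 Lemma 1.3.6.5 (p. 81)] [cite: Deligne1971TravauxShimura, 4.11–4.12 pp. 148–149] -/
theorem coe_lift_mulVec_smul_eq_restrictPt (hN : N ≠ 0) (hν : ν ≠ 0) {M : ℕ} (hNM : N ∣ M) (hM : M ≠ 0)
    (z : Fin g ⊕ Fin g → ℤ) :
    ((Λ.lift (ν * M) (Multiplicative.ofAdd fun j => (((γs *ᵥ ((M : ℤ) • z)) j : ℤ) : ZMod (ν * M)))) :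
        (A.fibre s).toAbelianVariety.Points Ω) =
      A.restrictPt s (φ'.section_ fun j => ((((N : ℤ) * (γs *ᵥ z) j : ℤ)) : ZMod (N * ν))) := by
  obtain ⟨k, hk⟩ := hNM
  have hk0 : k ≠ 0 := by rintro rfl; exact hM (by rw [hk, mul_zero])
  have hNν : N * ν ≠ 0 := Nat.mul_ne_zero hN hν
  haveI : NeZero (N * ν) := ⟨hNν⟩
  have hlev : ν * M = k * (N * ν) := by rw [hk]; ring
  rw [Λ.coe_lift_intCast_congr hlev, ← Λ.coe_lift_ofAdd_eq_restrictPt_section]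
  -- the vector at level `k·(N·ν)` is `k •` the lifted kernel vector
  have hx : (fun j => (((γs *ᵥ ((M : ℤ) • z)) j : ℤ) : ZMod (k * (N * ν)))) =
      k • fun j => ((((N : ℤ) * (γs *ᵥ z) j : ℤ)) : ZMod (k * (N * ν))) := by
    funext j
    rw [Matrix.mulVec_smul, Pi.smul_apply, Pi.smul_apply, smul_eq_mul, nsmul_eq_mul, hk]
    push_cast
    ring
  have hcast : (fun j => ZMod.castHom (Dvd.intro_left k rfl) (ZMod (N * ν))
      ((fun j => ((((N : ℤ) * (γs *ᵥ z) j : ℤ)) : ZMod (k * (N * ν)))) j)) =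
      fun j => ((((N : ℤ) * (γs *ᵥ z) j : ℤ)) : ZMod (N * ν)) := by
    funext j
    exact map_intCast _ _
  rw [hx, ofAdd_nsmul, map_pow, Subgroup.coe_pow, ← Λ.lift_compat k _ dvd_rfl hNν hk0, hcast]

/-- THE KERNEL IS KILLED: for `N ∣ M`, `u_s Λ_{νM}(γ⋆(M • z)) = 1`, given that the points `φ′(N·γ⋆z)(s)` lie in the
kernel of `u_s` (the Hecke kernel `γ⁻¹ℤ^{2g}/ℤ^{2g}` read through `φ′`). [cite: Deligne1971TravauxShimura, 4.11–4.12 pp. 148–149] -/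
theorem map_lift_mulVec_smul_eq_one (hN : N ≠ 0) (hν : ν ≠ 0)
    (hker : ∀ z : Fin g ⊕ Fin g → ℤ, AlgPoints.map (fibreHom u s).hom.hom.hom
      (A.restrictPt s (φ'.section_ fun j => ((((N : ℤ) * (γs *ᵥ z) j : ℤ)) : ZMod (N * ν)))) = 1)
    {M : ℕ} (hNM : N ∣ M) (hM : M ≠ 0) (z : Fin g ⊕ Fin g → ℤ) :
    AlgPoints.map (fibreHom u s).hom.hom.hom
        ((Λ.lift (ν * M) (Multiplicative.ofAdd fun j => (((γs *ᵥ ((M : ℤ) • z)) j : ℤ) : ZMod (ν * M)))) :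
          (A.fibre s).toAbelianVariety.Points Ω) = 1 := by
  rw [Λ.coe_lift_mulVec_smul_eq_restrictPt γs hN hν hNM hM z]
  exact hker z

/-- WELL-DEFINEDNESS MOD `M`: integer vectors congruent mod `M` have the same image `u_s Λ_{νM}(γ⋆ w)` (`N ∣ M`).
[cite: Lan2013PELCompactifications, §1.3.6 Lemma 1.3.6.5 (p. 81)] -/
theorem map_lift_mulVec_congr (hN : N ≠ 0) (hν : ν ≠ 0)
    (hker : ∀ z : Fin g ⊕ Fin g → ℤ, AlgPoints.map (fibreHom u s).hom.hom.hom
      (A.restrictPt s (φ'.section_ fun j => ((((N : ℤ) * (γs *ᵥ z) j : ℤ)) : ZMod (N * ν)))) = 1)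
    {M : ℕ} (hNM : N ∣ M) (hM : M ≠ 0) {w₁ w₂ : Fin g ⊕ Fin g → ℤ}
    (hw : ∀ j, ((w₁ j : ℤ) : ZMod M) = ((w₂ j : ℤ) : ZMod M)) :
    AlgPoints.map (fibreHom u s).hom.hom.hom
        ((Λ.lift (ν * M) (Multiplicative.ofAdd fun j => (((γs *ᵥ w₁) j : ℤ) : ZMod (ν * M)))) :
          (A.fibre s).toAbelianVariety.Points Ω) =
      AlgPoints.map (fibreHom u s).hom.hom.hom
        ((Λ.lift (ν * M) (Multiplicative.ofAdd fun j => (((γs *ᵥ w₂) j : ℤ) : ZMod (ν * M)))) :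
          (A.fibre s).toAbelianVariety.Points Ω) := by
  -- `w₁ = w₂ + M • z`
  have hdvd : ∀ j, (M : ℤ) ∣ w₁ j - w₂ j := fun j => (ZMod.intCast_eq_intCast_iff_dvd_sub _ _ _).1 (hw j).symm
  have hw₁ : w₁ = w₂ + (M : ℤ) • fun j => (w₁ j - w₂ j) / M := by
    funext j
    rw [Pi.add_apply, Pi.smul_apply, smul_eq_mul, Int.mul_ediv_cancel' (hdvd j)]
    ring
  rw [hw₁, Λ.map_lift_mulVec_add u γs, Λ.map_lift_mulVec_smul_eq_one u γs hN hν hker hNM hM, mul_one]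

/-- `M`-TORSION: `(u_s Λ_{νM}(γ⋆ w))^M = 1` for `N ∣ M`. [cite: Lan2013PELCompactifications, §1.3.6 Lemma 1.3.6.5 (p. 81)] -/
theorem map_lift_mulVec_pow_eq_one (hN : N ≠ 0) (hν : ν ≠ 0)
    (hker : ∀ z : Fin g ⊕ Fin g → ℤ, AlgPoints.map (fibreHom u s).hom.hom.hom
      (A.restrictPt s (φ'.section_ fun j => ((((N : ℤ) * (γs *ᵥ z) j : ℤ)) : ZMod (N * ν)))) = 1)
    {M : ℕ} (hNM : N ∣ M) (hM : M ≠ 0) (w : Fin g ⊕ Fin g → ℤ) :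
    AlgPoints.map (fibreHom u s).hom.hom.hom
        ((Λ.lift (ν * M) (Multiplicative.ofAdd fun j => (((γs *ᵥ w) j : ℤ) : ZMod (ν * M)))) :
          (A.fibre s).toAbelianVariety.Points Ω) ^ M = 1 := by
  rw [← Λ.map_lift_mulVec_nsmul u γs M M w]
  exact Λ.map_lift_mulVec_smul_eq_one u γs hN hν hker hNM hM w

/-- INJECTIVITY MOD `M`: if `u_s Λ_{νM}(γ⋆ w) = 1` then `w ∈ M·ℤ^{2g}` — the kernel of `u_s` is EXACTLY `φ′(N·γ⋆ℤ^{2g})(s)`,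
the tower is injective at level `νM`, and `γ γ⋆ = ν` (γ INTEGRAL) turns `γ⋆(w − Mz) ∈ νM·ℤ^{2g}` into `w − Mz ∈ M·γℤ^{2g}`.
[cite: Deligne1971TravauxShimura, 4.11–4.12 pp. 148–149] [cite: Lan2013PELCompactifications, §1.3.6 Lemma 1.3.6.5 (p. 81)] -/
theorem exists_eq_smul_of_map_lift_mulVec_eq_one (hN : N ≠ 0) (hν : ν ≠ 0)
    (γm : Matrix (Fin g ⊕ Fin g) (Fin g ⊕ Fin g) ℤ) (hγ : γm * γs = (ν : ℤ) • (1 : Matrix _ _ ℤ))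
    (hker : ∀ P : (A.fibre s).toAbelianVariety.Points Ω, AlgPoints.map (fibreHom u s).hom.hom.hom P = 1 →
      ∃ z : Fin g ⊕ Fin g → ℤ, P = A.restrictPt s (φ'.section_ fun j => ((((N : ℤ) * (γs *ᵥ z) j : ℤ)) : ZMod (N * ν))))
    {M : ℕ} (hNM : N ∣ M) (hM : M ≠ 0) {w : Fin g ⊕ Fin g → ℤ}
    (hw : AlgPoints.map (fibreHom u s).hom.hom.hom
        ((Λ.lift (ν * M) (Multiplicative.ofAdd fun j => (((γs *ᵥ w) j : ℤ) : ZMod (ν * M)))) :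
          (A.fibre s).toAbelianVariety.Points Ω) = 1) :
    ∃ z : Fin g ⊕ Fin g → ℤ, w = (M : ℤ) • z := by
  obtain ⟨z, hz⟩ := hker _ hw
  rw [← Λ.coe_lift_mulVec_smul_eq_restrictPt γs hN hν hNM hM z] at hz
  -- injectivity of the tower at level `νM`
  have hνM : N * ν ∣ ν * M := by
    obtain ⟨k, hk⟩ := hNM
    exact ⟨k, by rw [hk]; ring⟩
  have hinj := (Λ.lift_bijective hνM (Nat.mul_ne_zero hν hM)).1 (Subtype.ext hz)
  have hvec := Multiplicative.ofAdd.injective hinj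
  -- `γ⋆ (w − M z) = νM • t`
  have hdvd : ∀ j, ((ν * M : ℕ) : ℤ) ∣ (γs *ᵥ ((M : ℤ) • z)) j - (γs *ᵥ w) j := fun j =>
    (ZMod.intCast_eq_intCast_iff_dvd_sub _ _ _).1 (congrFun hvec j)
  set t : Fin g ⊕ Fin g → ℤ := fun j => ((γs *ᵥ ((M : ℤ) • z)) j - (γs *ᵥ w) j) / ((ν * M : ℕ) : ℤ) with ht
  have hd : γs *ᵥ ((M : ℤ) • z - w) = ((ν * M : ℕ) : ℤ) • t := by
    funext j
    rw [Matrix.mulVec_sub, Pi.sub_apply, Pi.smul_apply, smul_eq_mul, ht]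
    exact (Int.mul_ediv_cancel' (hdvd j)).symm
  -- apply `γ`: `ν • (Mz − w) = νM • γ t`
  have hγd : (ν : ℤ) • ((M : ℤ) • z - w) = (ν : ℤ) • ((M : ℤ) • (γm *ᵥ t)) := by
    have h1 : γm *ᵥ (γs *ᵥ ((M : ℤ) • z - w)) = (ν : ℤ) • ((M : ℤ) • z - w) := by
      rw [Matrix.mulVec_mulVec, hγ, Matrix.smul_mulVec, Matrix.one_mulVec]
    rw [← h1, hd, Matrix.mulVec_smul, Nat.cast_mul, mul_smul]
  have hνz : (ν : ℤ) ≠ 0 := by exact_mod_cast hν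
  have hcancel := smul_right_injective (Fin g ⊕ Fin g → ℤ) hνz hγd
  refine ⟨z - γm *ᵥ t, ?_⟩
  rw [smul_sub, ← hcancel, sub_sub_cancel]

/-- THE LEVEL CLAUSE: at level `N` the moved tower through `u` IS the induced level structure `ψφ = u ∘ φ′^ν` —
`u_s Λ_{νN}(γ⋆ eᵢ) = (φ′ᵢ^ν ≫ u)(s)`: `eᵢ ≡ γ eᵢ (mod N)` (the clause `γ ≡ 1 (mod N)` of the Hecke link) and
`γ⋆γ = ν`, so `γ⋆ eᵢ ≡ γ⋆γ eᵢ = ν eᵢ` modulo the kernel, and `Λ_{νN}(ν eᵢ) = Λ_{Nν}(eᵢ)^ν = φ′ᵢ(s)^ν`.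
[cite: Deligne1971TravauxShimura, 4.11–4.12 pp. 148–149] [cite: Lan2013PELCompactifications, §1.3.6 Lemma 1.3.6.5 (p. 81)] -/
theorem map_lift_mulVec_single (hN : N ≠ 0) (hν : ν ≠ 0)
    (γm : Matrix (Fin g ⊕ Fin g) (Fin g ⊕ Fin g) ℤ) (hγ' : γs * γm = (ν : ℤ) • (1 : Matrix _ _ ℤ))
    (hQA4 : ∀ k i, (N : ℤ) ∣ (γm - 1) k i)
    (hker : ∀ z : Fin g ⊕ Fin g → ℤ, AlgPoints.map (fibreHom u s).hom.hom.hom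
      (A.restrictPt s (φ'.section_ fun j => ((((N : ℤ) * (γs *ᵥ z) j : ℤ)) : ZMod (N * ν)))) = 1)
    {ψφ : B.LevelStructure g N} (hψφ : ∀ i, ψφ.σ i = (φ'.σ i ^ ν) ≫ u) (i : Fin g ⊕ Fin g) :
    AlgPoints.map (fibreHom u s).hom.hom.hom
        ((Λ.lift (ν * N) (Multiplicative.ofAdd fun j =>
            (((γs *ᵥ fun k => (((Pi.single i (1 : ZMod N) : Fin g ⊕ Fin g → ZMod N) k).val : ℤ)) j : ℤ) :
              ZMod (ν * N)))) : (A.fibre s).toAbelianVariety.Points Ω) =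
      B.restrictPt s (ψφ.σ i) := by
  haveI : NeZero N := ⟨hN⟩
  haveI : NeZero (N * ν) := ⟨Nat.mul_ne_zero hN hν⟩
  -- (a) replace the canonical lift of `eᵢ` by `γ eᵢ` (congruent mod `N` by `γ ≡ 1`)
  have hcong : ∀ j, (((fun k => (((Pi.single i (1 : ZMod N) : Fin g ⊕ Fin g → ZMod N) k).val : ℤ)) j : ℤ) :
      ZMod N) = (((γm *ᵥ Pi.single i (1 : ℤ)) j : ℤ) : ZMod N) := by
    intro j
    rw [Matrix.mulVec_single_one, Matrix.col_apply, Int.cast_natCast, ZMod.natCast_zmod_val]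
    have hj : ((γm j i : ℤ) : ZMod N) = (((1 : Matrix (Fin g ⊕ Fin g) (Fin g ⊕ Fin g) ℤ) j i : ℤ) : ZMod N) := by
      rw [ZMod.intCast_eq_intCast_iff_dvd_sub]
      have h := hQA4 j i
      rw [Matrix.sub_apply] at h
      rw [← neg_sub]
      exact (dvd_neg).2 h
    rw [hj, Matrix.one_apply, Pi.single_apply]
    split_ifs <;> simp
  rw [Λ.map_lift_mulVec_congr u γs hN hν hker dvd_rfl hN hcong]
  -- (b) `γ⋆ γ eᵢ = ν eᵢ`
  have hvec : (fun j => (((γs *ᵥ (γm *ᵥ Pi.single i (1 : ℤ))) j : ℤ) : ZMod (ν * N))) =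
      fun j => ((((ν : ℤ) • (Pi.single i (1 : ℤ) : Fin g ⊕ Fin g → ℤ)) j : ℤ) : ZMod (ν * N)) := by
    funext j
    rw [Matrix.mulVec_mulVec, hγ', Matrix.smul_mulVec, Matrix.one_mulVec]
  rw [hvec, Λ.coe_lift_intCast_congr (Nat.mul_comm ν N)]
  have hsingle : (fun j => ((((ν : ℤ) • (Pi.single i (1 : ℤ) : Fin g ⊕ Fin g → ℤ)) j : ℤ) : ZMod (N * ν))) =
      ν • (Pi.single i (1 : ZMod (N * ν)) : Fin g ⊕ Fin g → ZMod (N * ν)) := by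
    funext j
    rw [Pi.smul_apply, Pi.smul_apply, smul_eq_mul, nsmul_eq_mul, Pi.single_apply, Pi.single_apply]
    split_ifs <;> simp
  rw [hsingle, ofAdd_nsmul, map_pow, Subgroup.coe_pow, Λ.lift_level i, hψφ i, ← map_fibreHom_restrictPt s u,
    A.restrictPt_pow s]
  rfl

end LevelStructure.SymplecticLift

end AbelianSchemeOver

end Literature.AlgebraicGeometry.AbelianSchemes

end
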